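import Literature.Claims.NS.Shoji2026
import Literature.Analysis.FluidPDE.TimeDependentLinearFlow
import HarnessLib

/-!
# Refutation of Step 2 (Theorem 4.2) of Shoji (2026) (NS-claims census C92)

Claim file: `Literature.Claims.NS.Shoji2026` (T. Shoji, *Global Regularity of the 3D Navier–Stokes
Equations: A Logical Cost Functional Approach via Resource-Constrained Analysis*, Zenodo 18483326 (2026),
17 pp.; typed skeleton `Literature/Claims/NS/Shoji2026.lean`, whose `ClaimedTheorem` is Clay (A)).
Kernel certificate written by ns-claims-typist-9 g2 (kit `SoloRefuteShoji2026.typist9-kit.lean`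
sha16 71062e7fe037207c), read and adopted unchanged in content by the refuter of record
ns-claims-refuter-7 g0; the companion `depth_rest_eq_zero_of_Step3` is the refuter's.

* `not_Step2_Thm42 N` — Theorem 4.2 p.8 «D(t) ≥ ν·δ·4^{N(t)}» with one `δ > 0` is false along the REST
  STATE `u ≡ 0`, `p ≡ 0` (a classical finite-energy solution of the unforced system for every `ν > 0`;
  tree `LinearFlow.isClassicalNSSolutionOn_const` with `S₀ = 0`): `D ≡ 0 < ν·δ ≤ ν·δ·4^{N}` — for EVERY depth
  attachment `N` (so the Littlewood–Paley definition of `N(t)` is immaterial). The same failure occurs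
  along every decaying flow at large times (`∫D < ∞`), on paper.
* `depth_rest_eq_zero_of_Step3 N` — Theorem 4.3 p.8 («N(t) ≤ ½ log₂(D(t)/(νδ))», the printed inversion
  of Theorem 4.2) survives the rest state only through Lean's junk value `Real.logb 2 0 = 0`, and then
  pins the depth of the rest state to `0` at every `t ≥ 0` (in print `log₂ 0 = −∞`: the inversion of a
  false floor). Recorded so that the adjudication can see exactly what Step 3 says on the witness.
* Theorem 4.1 p.7 (`Step1_Thm41 N`, first in print) is not touched here: with `N` abstract the statement
  is satisfiable for suitable attachments (take `N u t` large), so no attachment-uniform kernel face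
  exists at this grain; its failure for the paper's own `N` (Def. 2.2) is a paper-level finding.

WHAT THIS IS NOT: not a claim about NS regularity or blow-up; not a claim about any author beyond the
typed locator.
-/

noncomputable section

set_option linter.dupNamespace false

open Set MeasureTheory
open scoped ENNReal

namespace Summit.NavierStokesRegularity.NavierStokesRegularity.Theorems.Shoji2026

open Literature.Analysis.FluidPDE Literature.Claims.NS.Shoji2026

/-- The rest state is a flow of the class for every viscosity. [cite: Shoji2026, Theorem 3.1 p.6] -/
theorem isFlow_zero (ν : ℝ) : IsFlow ν (fun _ _ => 0) (fun _ _ => 0) := by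
  refine ⟨?_, ?_⟩
  · have h := LinearFlow.isClassicalNSSolutionOn_const (E := E3) (uniqueDiffOn_Ici 0) ν 0
      (by simp) (fun x y => by simp)
    have hu : (fun (_ : ℝ) (x : E3) => (0 : E3 →L[ℝ] E3) x) = fun _ _ => 0 := by
      funext t x; simp
    have hp : (fun (_ : ℝ) (x : E3) => -(2⁻¹ * inner ℝ x ((0 : E3 →L[ℝ] E3) ((0 : E3 →L[ℝ] E3) x)))) =
        fun _ _ => (0 : ℝ) := by
      funext t x; simp
    rw [hu, hp] at h
    exact h
  · refine ⟨0, by simp, fun t _ => ?_⟩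
    simp

/-- The dissipation of the rest state vanishes. [cite: Shoji2026, Theorem 3.1 p.6] -/
theorem dissipation_zero (ν t : ℝ) : dissipation ν (fun _ _ => 0) t = 0 := by
  simp [dissipation]

/-- **`¬ Step 2`** for every depth attachment `N`. [cite: Shoji2026, Theorem 4.2 p.8] -/
theorem not_Step2_Thm42 (N : Depth) : ¬ Literature.Claims.NS.Shoji2026.Step2_Thm42 N := by
  rintro ⟨δ, hδ, h⟩
  have h1 := h 1 (fun _ _ => 0) (fun _ _ => 0) one_pos (isFlow_zero 1) 0 le_rfl
  rw [dissipation_zero] at h1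
  have hpow : (1 : ℝ) ≤ (4 : ℝ) ^ (N (fun _ _ => 0) 0) := one_le_pow₀ (by norm_num)
  nlinarith

/-- **Step 3 on the witness.** If Theorem 4.3 holds (with its one `δ > 0`), then along the rest state the
depth attachment vanishes at every `t ≥ 0` — because `D ≡ 0` and `Real.logb 2 0 = 0` (Lean's junk value;
the print's `log₂ 0` is `−∞`). [cite: Shoji2026, Theorem 4.3 p.8] -/
theorem depth_rest_eq_zero_of_Step3 (N : Depth) (h : Literature.Claims.NS.Shoji2026.Step3_Thm43 N)
    (t : ℝ) (ht : 0 ≤ t) : N (fun _ _ => 0) t = 0 := by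
  obtain ⟨δ, _, h⟩ := h
  have h1 := h 1 (fun _ _ => 0) (fun _ _ => 0) one_pos (isFlow_zero 1) t ht
  rw [dissipation_zero, zero_div, Real.logb_zero, mul_zero] at h1
  exact_mod_cast le_antisymm h1 (Nat.cast_nonneg _)

end Summit.NavierStokesRegularity.NavierStokesRegularity.Theorems.Shoji2026

end
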